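import Literature.MathematicalPhysics.QuantumFieldTheory.Balaban1983to89.B11Eq183Differentiation

/-!
# [Balaban1985Variational] Sect. G AT THE ORIGIN `B = 0`: the actual derivative of the (179) chart is `(1 + G̃Δ⁽²⁾)H₀`, the
# second derivative of `𝒜₀` is one tree graph — the Neumann series (188) and the kernel (189) do NOT enter at `B = 0`
# (`Beta.RemainderChartOriginDerivative`)

HONEST FRAMING (cell rule, page 1 of everything).  Discharging `BetaPertH` makes Bałaban's UV stability UNCONDITIONAL — a
real constructive-QFT result; it is NOT the continuum limit and NOT the Clay problem.  This module discharges NOTHING of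
`BetaPertH`.  It is a SCHEME-LEVEL computation over lit-balaban r08's Sect. E–G contraction scheme (`B11Eq174Chart.Regime`,
`B11Eq183Differentiation.solA180` ∕ `chartH179`, all kernel theorems there) serving binder row (D4) of the β-flow team: the row's
NODE D socket `Beta.RemainderDecay190.Data190.dHn` is ONE linear map per torus — the B-derivative of the restricted minimizer AT
`B = 0` ([I] (4.35): `(δ/δB)𝐇_k(□₀, 0)`) — and for THAT object the letter list of [15] Prop. 9 (190) collapses.

CITATION HEADER (lean-in-tree rule 2026-08-18).  [15] = T. Bałaban, *The variational problem and background fields in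
renormalization group method for lattice gauge theories*, Commun. Math. Phys. **102**, 277–309 (1985) [Balaban1985Variational]
(held `paper:balaban1985-cmp102-variational-background`; journal page = PDF page + 276), read by generation 103 of this unit on
the `lit read` text layer: (78)–(80) p. 290 (*"The expression ⟨HD(A′), J⟩ may be decomposed into terms of second and higher
orders. Taking into account that the second order term D⁽²⁾(A′) in the expansion of D(A′) is equal to C⁽²⁾(A′) … (78) …
Now let us write higher order terms. They determine the functional V(A′) = −⟨HD₃(A′), J⟩ − ⟨A′, Δ_Π HD(A′)⟩ + ½⟨HD(A′),
Δ_Π HD(A′)⟩ + V₀(A′ − HD(A′)). (80)"* — `V` IS the part of order ≥ 3 of the action functional around the background, so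
`(δ/δA′)V` is of second order at `A′ = 0`: this is the regime's axiom `Regime.quad`, (98) p. 293 ∕ Prop. 4), p. 289 after
Prop. 3 (*"The operator 𝔇(A′) is an analytic function in A′, and its expansion begins with a linear term in A′"* — the Sect. C
map `D` is of second order, `𝔇(0) = 0`), (179)–(180) p. 306, (182)–(184) p. 307, (188)–(190) p. 308, Prop. 9 p. 309; the
displays (182)–(184), (188) in the transcription of record of `B11SectG` ∕ `B11Eq183Differentiation`.  [I] = T. Bałaban,
*Renormalization group approach to lattice gauge field theories. I*, Commun. Math. Phys. **109**, 249–301 (1987)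
[Balaban1987RG1], (4.35) p. 290 (the r = 2 term at `𝐁 = 0`), p. 282.

## What is PROVED here (kernel-checked; 0 sorry; no `def`)

Scheme data as in `B11Eq183Differentiation`: complex Banach spaces `𝒳 ∋ B`, `𝒴`, `𝒵`, `𝒢 : 𝒵 →L[ℂ] 𝒴` (G̃), `W : 𝒴 → 𝒵`
((δ/δA′)V), `D2 : 𝒴 →L[ℂ] 𝒵` (Δ⁽²⁾), `H₀ : 𝒳 →L[ℂ] 𝒴`, a `Regime 𝒢 0 W B₀ θ C₄ a₃ j a ε₄` ((117)–(121)) with `0 < j`, `0 < a`,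
Prop. 4's analyticity letter `hWa`; a Sect. C map `D : 𝒴 → 𝒲` with `H : 𝒲 →L[ℂ] 𝒴`.
(K1) (private helper: a map with `‖f Y‖ ≤ C‖Y‖²` on a ball has Fréchet derivative `0` at `0` [folklore]);
**`fderiv_W_zero`** — `((δ²/δA′²)V)(0) = 0` FROM THE REGIME (`Regime.quad`); `solA180_zero` ∕ `base180_zero` — at `B = 0` the
base point `𝒜₀(0) + H₀0` of (183)–(189) IS `0` (`Regime.solA_zero`); `fderiv_W_base_zero` (generation 101's hypothesis `hW`).
(K2) **`fderiv_solA180_zero`** — (184) at `B = 0`: `𝔄₀(0) = (δ/δB)𝒜₀(0) = G̃Δ⁽²⁾H₀` (the operator `G̃((δ²/δA′²)V)(𝒜₀ + H₀B)`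
inverted in (188) is ZERO at `B = 0`); **`fderiv_chartH179_zero`** — (182) at `B = 0` for a Sect. C map with `𝔇(0) = 0`:
`(δ/δB)𝓗(0) = H₀ + G̃Δ⁽²⁾H₀`; `fderiv_chartH179_zero_of_norm_le_sq` (the same from a quadratic bound on `D`),
`fderiv_chartH179_zero_of_tangent` ∕ `fderiv_chartH179_zero_of_hTD` (generic Sect. C map `Tm` tangent to `id` at `0`, resp. r08's (177)
letter `‖Tm Y − Y‖ ≤ K_D‖Y‖²` verbatim);
**`fderiv_chartH179_zero_of_flat`** (`Δ⁽²⁾H₀ = 0` ⇒ `(δ/δB)𝓗(0) = H₀` — generation 101's `fderiv_chartH179_zero_eq_H0` WITHOUT its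
hypotheses `fderiv W = 0`, which is a theorem of the regime, and with `𝔇 = 0` read from the second order of `D`).
(K3) THE (190) LETTER AT THE ORIGIN in `B11SectG`'s currency (any geometry, any block sizes; generic Sect. C map `Tm` tangent to
`id` at `0` — the case `Y ↦ Y − H(D Y)` by `hasFDerivAt_sectC_id`): **`hasMaj_fderiv_chartH179_zero`**
(majorants of `H₀` and of `G̃Δ⁽²⁾H₀` add), **`ineq190_fderiv_chartH179_zero`** (exponential letters `A₀e^{−ρd}`, `A₁e^{−ρd}` ⇒
`Ineq190 … (A₀ + A₁) δ` for `δ/8 ≤ ρ`), **`ineq190_fderiv_chartH179_zero_of_letters`** (from the three located leaves `hH0` (H₀),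
`hG` (G̃), `hD2H0` (Δ⁽²⁾H₀) by `hasMaj_comp_exp` with (2.54) ∕ (2.61): constant `A₀ + κ₃·B_G·c_Δ·c`, one rate loss `σ`), and the flat
reading `ineq190_fderiv_chartH179_zero_of_flat` (the letter of `H₀` IS the letter of `(δ/δB)𝓗(0)`).
(K4) SECOND ORDER AT THE ORIGIN ([I] p. 282: *"(δ^{n(p)}/δB^{n(p)})H_j(□₀, 0) … tree graph with n(p) initial points and one final
point"*, n(p) = 2; p. 306: *"solving a recursive system of equations"*): `fderiv_solA180_eventuallyEq` ((183)/(184) as an identity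
of CLM-valued functions near 0), **`fderiv_fderiv_solA180_zero`** (`D(𝔄₀)(0)·v = −G̃ ∘ ((δ³/δA′³)V)(0)(M v) ∘ M`,
`M = (1 + G̃Δ⁽²⁾)H₀` — differentiating (183) at `B = 0` the term with the unknown `D𝔄₀(0)` carries the factor `((δ²/δA′²)V)(0) = 0`:
ONE tree graph with two initial points, no Neumann series, no (189)), `fderiv_fderiv_solA180_zero_apply`.

## Consequence for row (D4) (bookkeeping-grade; recorded, not claimed as mathematics of Bałaban's beyond the scheme)

`B11Ineq190Actual.ineq190_sectG` proves (190) UNIFORMLY ON THE DOMAIN OF (180) and therefore carries (189) `h189`, the Neumann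
smallness (187) `hq`, the letters of `H` (46) `hH` and of `𝔇` (73) `hDfr`; generation 101's `RemainderDecay190TwoGridActual` feeds
that to `Data190`.  For the socket's actual subject — the derivative AT `B = 0` — none of these is needed: the letters are `hH0` and
the majorant of `G̃Δ⁽²⁾H₀` (flat background: `Δ⁽²⁾H₀ = 0`, letter `hH0` alone, inhabited hypothesis-free by Bałaban's flat `H_k` in
`RemainderDecay190TwoGridHk`).  (189) («we do not perform these calculations here», p. 308) stays Bałaban's for `B ≠ 0`.

## What is NOT claimed

* Nothing printed is used as a hypothesis beyond r08's typed regime (117)–(121) and Prop. 4's analyticity; the second order of the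
  Sect. C map `D` enters as the hypothesis `HasFDerivAt D 0 0` (or a quadratic bound), a statement about Bałaban's (47)/(64) CARRIED.
* `((δ³/δA′³)V)(0) = fderiv ℂ (fderiv ℂ W) 0` is scheme data (for Bałaban's `V` of (80): the cubic vertex of the action + the `D`-terms
  of (78) — not constructed); the chart's own second-order vertex `D²Tm(0)` (the `−HD⁽²⁾` of (78)) is not typed.
* No lattice object is constructed; `G̃`, `Δ⁽²⁾`, `H₀`, `V`, `D`, `H` are scheme data.  No `Literature` fact is minted; no `axiom`,
  no `sorry`.  NOT summit progress, NOT the continuum limit, NOT Clay.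
-/

namespace Literature.MathematicalPhysics.QuantumFieldTheory.Balaban1983to89.Beta.RemainderChartOriginDerivative

open Metric Set Filter Topology Asymptotics
open Literature.MathematicalPhysics.QuantumFieldTheory.Balaban1983to89 B11SectG
open Literature.MathematicalPhysics.QuantumFieldTheory.Balaban1983to89.B6RandomWalk (Triangle254)
open Literature.MathematicalPhysics.QuantumFieldTheory.Balaban1983to89.B11Eq174Chart (Regime)
open Literature.MathematicalPhysics.QuantumFieldTheory.Balaban1983to89.B11Eq183Differentiation
  (solA180 chartH179 solA180_def eq184 fderiv_chartH179_eq182 hasFDerivAt_chartH179_eq182 hasFDerivAt_chartH179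
    isOpen_dom180 hasFDerivAt_solA180 analyticAt_solA180)

noncomputable section

/-! ## 1. Second order at the origin: `((δ²/δA′²)V)(0) = 0` from the regime; the base point of Sect. G at `B = 0` is `0` -/

section Origin

variable {𝒳 𝒴 𝒵 : Type*} [NormedAddCommGroup 𝒳] [NormedSpace ℂ 𝒳] [NormedAddCommGroup 𝒴] [NormedSpace ℂ 𝒴]
  [NormedAddCommGroup 𝒵] [NormedSpace ℂ 𝒵]

/-- A map with a quadratic bound `‖f Y‖ ≤ C‖Y‖²` on a ball `‖Y‖ < r` (`r > 0`) has Fréchet derivative `0` at `0` (and `f 0 = 0`).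
[folklore] -/
private theorem hasFDerivAt_zero_of_norm_le_sq {f : 𝒴 → 𝒵} {C r : ℝ} (hr : 0 < r)
    (hf : ∀ Y : 𝒴, ‖Y‖ < r → ‖f Y‖ ≤ C * ‖Y‖ ^ 2) : HasFDerivAt f (0 : 𝒴 →L[ℂ] 𝒵) 0 := by
  have hf0 : f 0 = 0 := by
    have h := hf 0 (by rwa [norm_zero])
    rw [norm_zero, zero_pow two_ne_zero, mul_zero] at h
    exact norm_le_zero_iff.mp h
  rw [hasFDerivAt_iff_isLittleO_nhds_zero]
  have hbig : (fun h : 𝒴 => f (0 + h) - f 0 - (0 : 𝒴 →L[ℂ] 𝒵) h) =O[𝓝 0] fun h => ‖h‖ ^ 2 := by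
    refine IsBigO.of_bound C ?_
    filter_upwards [ball_mem_nhds (0 : 𝒴) hr] with h hh
    rw [mem_ball, dist_zero_right] at hh
    rw [zero_add, hf0, sub_zero, zero_apply, sub_zero, Real.norm_of_nonneg (by positivity)]
    exact hf h hh
  exact hbig.trans_isLittleO (isLittleO_norm_pow_id one_lt_two)

variable {𝒢 : 𝒵 →L[ℂ] 𝒴} {Λ : 𝒴 →L[ℂ] 𝒴} {W : 𝒴 → 𝒵} {D2 : 𝒴 →L[ℂ] 𝒵} {H₀ : 𝒳 →L[ℂ] 𝒴} {B₀ θ C₄ a₃ j a ε₄ : ℝ}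

/-- **`((δ²/δA′²)V)(0) = 0`** — the second variational derivative of `V` VANISHES AT THE BASE CONFIGURATION, from the regime's
axiom that `W = (δ/δA′)V` is quadratic-analytic (`Regime.quad`: `‖W Y‖ ≤ C₄‖Y‖²` on `‖Y‖ < a₃`; [15] (80): `V` collects the terms
of order ≥ 3 of the action around the background; (98) p. 293). [cite: Balaban1985Variational, (80) p.290, (98) p.293, (117)-(121) p.295] -/
theorem fderiv_W_zero (R : Regime 𝒢 Λ W B₀ θ C₄ a₃ j a ε₄) (ha : 0 < a) : fderiv ℂ W 0 = 0 := by
  have ha₃ : 0 < a₃ := by linarith [R.dom, R.ε₄_nonneg]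
  exact (hasFDerivAt_zero_of_norm_le_sq ha₃ R.quad.quad).fderiv

/-- `W` is differentiable at `0` with derivative `0`. [cite: Balaban1985Variational, (98) p.293] -/
theorem hasFDerivAt_W_zero (R : Regime 𝒢 Λ W B₀ θ C₄ a₃ j a ε₄) (ha : 0 < a) :
    HasFDerivAt W (0 : 𝒴 →L[ℂ] 𝒵) 0 := by
  have ha₃ : 0 < a₃ := by linarith [R.dom, R.ε₄_nonneg]
  exact hasFDerivAt_zero_of_norm_le_sq ha₃ R.quad.quad

variable [CompleteSpace 𝒴]

/-- **`𝒜₀(0) = 0`**: at `B = 0` the selected solution of (180) is `0` (`Regime.solA_zero`: `J = −Δ⁽²⁾H₀0 = 0`, `𝔄 = H₀0 = 0`).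
[cite: Balaban1985Variational, (180) p.306, Prop. 9 p.309] -/
theorem solA180_zero (R : Regime 𝒢 0 W B₀ θ C₄ a₃ j a ε₄) (hj : 0 ≤ j) (ha : 0 < a) :
    solA180 𝒢 W D2 H₀ ε₄ (0 : 𝒳) = 0 := by
  rw [solA180_def, map_zero, map_zero, neg_zero]
  exact R.solA_zero hj ha

/-- **The base point of (183)–(189) at `B = 0` is the origin**: `𝒜₀(0) + H₀0 = 0`. [cite: Balaban1985Variational, (183) p.307] -/
theorem base180_zero (R : Regime 𝒢 0 W B₀ θ C₄ a₃ j a ε₄) (hj : 0 ≤ j) (ha : 0 < a) :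
    solA180 𝒢 W D2 H₀ ε₄ (0 : 𝒳) + H₀ 0 = 0 := by
  rw [solA180_zero R hj ha, map_zero, add_zero]

/-- `((δ²/δA′²)V)(𝒜₀(0) + H₀0) = 0` — generation 101's hypothesis `hW` of `fderiv_chartH179_zero_eq_H0`
(`RemainderDecay190TwoGridActual`) IS a theorem of the regime. [cite: Balaban1985Variational, (184) p.307, (98) p.293] -/
theorem fderiv_W_base_zero (R : Regime 𝒢 0 W B₀ θ C₄ a₃ j a ε₄) (hj : 0 ≤ j) (ha : 0 < a) :
    fderiv ℂ W (solA180 𝒢 W D2 H₀ ε₄ (0 : 𝒳) + H₀ 0) = 0 := by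
  rw [base180_zero R hj ha, fderiv_W_zero R ha]

/-- Hence **the operator inverted in (188) vanishes at `B = 0`**: `G̃((δ²/δA′²)V)(𝒜₀(0) + H₀0) = 0`.
[cite: Balaban1985Variational, (184) p.307, (188) p.308] -/
theorem comp_fderiv_W_base_zero (R : Regime 𝒢 0 W B₀ θ C₄ a₃ j a ε₄) (hj : 0 ≤ j) (ha : 0 < a) :
    𝒢 ∘L fderiv ℂ W (solA180 𝒢 W D2 H₀ ε₄ (0 : 𝒳) + H₀ 0) = 0 := by
  rw [fderiv_W_base_zero R hj ha, ContinuousLinearMap.comp_zero]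

variable [CompleteSpace 𝒳] [CompleteSpace 𝒵]

/-- **(184) AT `B = 0`: `𝔄₀(0) = (δ/δB)𝒜₀(0) = G̃Δ⁽²⁾H₀`** — no Neumann series: the perturbation `G̃((δ²/δA′²)V)(·)` of (184) is zero
at the base point (`comp_fderiv_W_base_zero`), so `B11Eq183Differentiation.eq184` reduces to this identity.
[cite: Balaban1985Variational, (183)-(184) p.307, (188) p.308] -/
theorem fderiv_solA180_zero (R : Regime 𝒢 0 W B₀ θ C₄ a₃ j a ε₄) (hWa : AnalyticOnNhd ℂ W {Y : 𝒴 | ‖Y‖ < a₃})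
    (hj : 0 < j) (ha : 0 < a) :
    fderiv ℂ (solA180 𝒢 W D2 H₀ ε₄) (0 : 𝒳) = 𝒢 ∘L (D2 ∘L H₀) := by
  have hJ : ‖D2 (H₀ (0 : 𝒳))‖ < j := by rw [map_zero, map_zero, norm_zero]; exact hj
  have h𝔄 : ‖H₀ (0 : 𝒳)‖ < a := by rw [map_zero, norm_zero]; exact ha
  have h := eq184 R hWa hJ h𝔄
  rw [comp_fderiv_W_base_zero R hj.le ha, ContinuousLinearMap.zero_comp, ContinuousLinearMap.zero_comp, add_zero,
    sub_zero] at h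
  exact h

/-- **(182) AT `B = 0`: `(δ/δB)𝓗(0) = H₀ + G̃Δ⁽²⁾H₀`** for the chart `𝓗(B) = (𝒜₀ + H₀B) − HD(𝒜₀ + H₀B)` (179) with a Sect. C map
`D` whose derivative at the base point `0` vanishes (`𝔇(0) = 0`: *"its expansion begins with a linear term in A′"*, p. 289) —
FOR EVERY SCHEME IN THE REGIME, i.e. for every background field: (189), (187)–(188), the letters of `H` and `𝔇` do not enter.
[cite: Balaban1985Variational, (179) p.306, (182)-(184) p.307, p.289] -/
theorem fderiv_chartH179_zero {𝒲 : Type*} [NormedAddCommGroup 𝒲] [NormedSpace ℂ 𝒲]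
    (R : Regime 𝒢 0 W B₀ θ C₄ a₃ j a ε₄) (hWa : AnalyticOnNhd ℂ W {Y : 𝒴 | ‖Y‖ < a₃}) (hj : 0 < j) (ha : 0 < a)
    {D : 𝒴 → 𝒲} (H : 𝒲 →L[ℂ] 𝒴) (hD : HasFDerivAt D (0 : 𝒴 →L[ℂ] 𝒲) 0) :
    fderiv ℂ (chartH179 𝒢 W D2 H₀ (fun Y : 𝒴 => Y - H (D Y)) ε₄) (0 : 𝒳) = H₀ + 𝒢 ∘L (D2 ∘L H₀) := by
  have hJ : ‖D2 (H₀ (0 : 𝒳))‖ < j := by rw [map_zero, map_zero, norm_zero]; exact hj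
  have h𝔄 : ‖H₀ (0 : 𝒳)‖ < a := by rw [map_zero, norm_zero]; exact ha
  have hD' : HasFDerivAt D (0 : 𝒴 →L[ℂ] 𝒲) (solA180 𝒢 W D2 H₀ ε₄ (0 : 𝒳) + H₀ 0) := by
    rwa [base180_zero R hj.le ha]
  rw [fderiv_chartH179_eq182 R hWa hJ h𝔄 H hD', fderiv_solA180_zero R hWa hj ha, ContinuousLinearMap.zero_comp,
    ContinuousLinearMap.comp_zero, sub_zero, add_comm]

/-- The chart HAS this derivative at `0` (differentiability included). [cite: Balaban1985Variational, (182) p.307, Prop. 9 p.309] -/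
theorem hasFDerivAt_chartH179_zero {𝒲 : Type*} [NormedAddCommGroup 𝒲] [NormedSpace ℂ 𝒲]
    (R : Regime 𝒢 0 W B₀ θ C₄ a₃ j a ε₄) (hWa : AnalyticOnNhd ℂ W {Y : 𝒴 | ‖Y‖ < a₃}) (hj : 0 < j) (ha : 0 < a)
    {D : 𝒴 → 𝒲} (H : 𝒲 →L[ℂ] 𝒴) (hD : HasFDerivAt D (0 : 𝒴 →L[ℂ] 𝒲) 0) :
    HasFDerivAt (chartH179 𝒢 W D2 H₀ (fun Y : 𝒴 => Y - H (D Y)) ε₄) (H₀ + 𝒢 ∘L (D2 ∘L H₀)) (0 : 𝒳) := by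
  have hJ : ‖D2 (H₀ (0 : 𝒳))‖ < j := by rw [map_zero, map_zero, norm_zero]; exact hj
  have h𝔄 : ‖H₀ (0 : 𝒳)‖ < a := by rw [map_zero, norm_zero]; exact ha
  have hD' : HasFDerivAt D (0 : 𝒴 →L[ℂ] 𝒲) (solA180 𝒢 W D2 H₀ ε₄ (0 : 𝒳) + H₀ 0) := by
    rwa [base180_zero R hj.le ha]
  have h := hasFDerivAt_chartH179_eq182 R hWa hJ h𝔄 H hD'
  rwa [fderiv_solA180_zero R hWa hj ha, ContinuousLinearMap.zero_comp, ContinuousLinearMap.comp_zero, sub_zero,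
    add_comm] at h

/-- The same with the second order of `D` given as a quadratic bound `‖D Y‖ ≤ K‖Y‖²` on a ball ([15] (78): `D = D⁽²⁾ + D₃`).
[cite: Balaban1985Variational, (78) p.290, (182) p.307] -/
theorem fderiv_chartH179_zero_of_norm_le_sq {𝒲 : Type*} [NormedAddCommGroup 𝒲] [NormedSpace ℂ 𝒲]
    (R : Regime 𝒢 0 W B₀ θ C₄ a₃ j a ε₄) (hWa : AnalyticOnNhd ℂ W {Y : 𝒴 | ‖Y‖ < a₃}) (hj : 0 < j) (ha : 0 < a)
    {D : 𝒴 → 𝒲} (H : 𝒲 →L[ℂ] 𝒴) {K r : ℝ} (hr : 0 < r) (hDq : ∀ Y : 𝒴, ‖Y‖ < r → ‖D Y‖ ≤ K * ‖Y‖ ^ 2) :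
    fderiv ℂ (chartH179 𝒢 W D2 H₀ (fun Y : 𝒴 => Y - H (D Y)) ε₄) (0 : 𝒳) = H₀ + 𝒢 ∘L (D2 ∘L H₀) :=
  fderiv_chartH179_zero R hWa hj ha H (hasFDerivAt_zero_of_norm_le_sq hr hDq)

omit [CompleteSpace 𝒴] [CompleteSpace 𝒳] [CompleteSpace 𝒵] in
/-- The Sect. C map `Y ↦ Y − H(D Y)` is tangent to the identity at `0` when `D` is of second order there (`𝔇(0) = 0`).
[cite: Balaban1985Variational, (47) p.285, p.289] -/
theorem hasFDerivAt_sectC_id {𝒲 : Type*} [NormedAddCommGroup 𝒲] [NormedSpace ℂ 𝒲] {D : 𝒴 → 𝒲} (H : 𝒲 →L[ℂ] 𝒴)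
    (hD : HasFDerivAt D (0 : 𝒴 →L[ℂ] 𝒲) 0) :
    HasFDerivAt (fun Y : 𝒴 => Y - H (D Y)) (ContinuousLinearMap.id ℂ 𝒴) 0 := by
  have h := (hasFDerivAt_id (𝕜 := ℂ) (0 : 𝒴)).sub (H.hasFDerivAt.comp (0 : 𝒴) hD)
  rwa [ContinuousLinearMap.comp_zero, sub_zero] at h

/-- **The same for a GENERIC Sect. C map `Tm` (47) tangent to the identity at `0`** (`HasFDerivAt Tm id 0`: r08's chart datum
`Tm`, print's `A′ ↦ A′ − HD(A′)` with `HD` of second order): `(δ/δB)𝓗(0) = H₀ + G̃Δ⁽²⁾H₀`.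
[cite: Balaban1985Variational, (179) p.306, (182) p.307, (177) p.306] -/
theorem fderiv_chartH179_zero_of_tangent (R : Regime 𝒢 0 W B₀ θ C₄ a₃ j a ε₄)
    (hWa : AnalyticOnNhd ℂ W {Y : 𝒴 | ‖Y‖ < a₃}) (hj : 0 < j) (ha : 0 < a) {Tm : 𝒴 → 𝒴}
    (hTm : HasFDerivAt Tm (ContinuousLinearMap.id ℂ 𝒴) 0) :
    fderiv ℂ (chartH179 𝒢 W D2 H₀ Tm ε₄) (0 : 𝒳) = H₀ + 𝒢 ∘L (D2 ∘L H₀) := by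
  have hJ : ‖D2 (H₀ (0 : 𝒳))‖ < j := by rw [map_zero, map_zero, norm_zero]; exact hj
  have h𝔄 : ‖H₀ (0 : 𝒳)‖ < a := by rw [map_zero, norm_zero]; exact ha
  have hTm' : HasFDerivAt Tm (ContinuousLinearMap.id ℂ 𝒴) (solA180 𝒢 W D2 H₀ ε₄ (0 : 𝒳) + H₀ 0) := by
    rwa [base180_zero R hj.le ha]
  have h := hasFDerivAt_chartH179 R hWa hJ h𝔄 hTm'
  rw [fderiv_solA180_zero R hWa hj ha, ContinuousLinearMap.id_comp, add_comm] at h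
  exact h.fderiv

/-- **The same from r08's (177) letter verbatim**: `‖Tm Y − Y‖ ≤ K_D‖Y‖²` on the ball `‖Y‖ < ε₄ + a` («HD of second order»,
`B11Eq174Chart.Regime.norm_chartH_sub_self_le`'s hypothesis `hTD`) ⇒ `(δ/δB)𝓗(0) = H₀ + G̃Δ⁽²⁾H₀`.
[cite: Balaban1985Variational, (177) p.306, (56) p.287, (182) p.307] -/
theorem fderiv_chartH179_zero_of_hTD (R : Regime 𝒢 0 W B₀ θ C₄ a₃ j a ε₄)
    (hWa : AnalyticOnNhd ℂ W {Y : 𝒴 | ‖Y‖ < a₃}) (hj : 0 < j) (ha : 0 < a) {Tm : 𝒴 → 𝒴} {K_D : ℝ}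
    (hTD : ∀ Y : 𝒴, ‖Y‖ < ε₄ + a → ‖Tm Y - Y‖ ≤ K_D * ‖Y‖ ^ 2) :
    fderiv ℂ (chartH179 𝒢 W D2 H₀ Tm ε₄) (0 : 𝒳) = H₀ + 𝒢 ∘L (D2 ∘L H₀) := by
  have hr : 0 < ε₄ + a := by linarith [R.ε₄_nonneg]
  have h0 : HasFDerivAt (fun Y : 𝒴 => Tm Y - Y) (0 : 𝒴 →L[ℂ] 𝒴) 0 := hasFDerivAt_zero_of_norm_le_sq hr hTD
  have hTm : HasFDerivAt Tm (ContinuousLinearMap.id ℂ 𝒴) 0 := by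
    have h := h0.add (hasFDerivAt_id (𝕜 := ℂ) (0 : 𝒴))
    have e : ((fun Y : 𝒴 => Tm Y - Y) + id) = Tm := funext fun Y => by simp
    rwa [zero_add, e] at h
  exact fderiv_chartH179_zero_of_tangent R hWa hj ha hTm

/-- **FLAT BACKGROUND: `(δ/δB)𝓗(0) = H₀`** when `Δ⁽²⁾H₀ = 0` (at `U = 1` the second-order piece `Δ⁽²⁾` of (143)/(180) vanishes —
a reading of [15] with [B9] (3.137), CARRIED as the hypothesis `hD2`).  Generation 101's `fderiv_chartH179_zero_eq_H0` assumed in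
addition `fderiv W (base) = 0`, which is `fderiv_W_zero` + `base180_zero` here. [cite: Balaban1985Variational, (180) p.306, (182) p.307] -/
theorem fderiv_chartH179_zero_of_flat {𝒲 : Type*} [NormedAddCommGroup 𝒲] [NormedSpace ℂ 𝒲]
    (R : Regime 𝒢 0 W B₀ θ C₄ a₃ j a ε₄) (hWa : AnalyticOnNhd ℂ W {Y : 𝒴 | ‖Y‖ < a₃}) (hj : 0 < j) (ha : 0 < a)
    {D : 𝒴 → 𝒲} (H : 𝒲 →L[ℂ] 𝒴) (hD : HasFDerivAt D (0 : 𝒴 →L[ℂ] 𝒲) 0) (hD2 : D2 ∘L H₀ = 0) :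
    fderiv ℂ (chartH179 𝒢 W D2 H₀ (fun Y : 𝒴 => Y - H (D Y)) ε₄) (0 : 𝒳) = H₀ := by
  rw [fderiv_chartH179_zero R hWa hj ha H hD, hD2, ContinuousLinearMap.comp_zero, add_zero]

/-- Flat background, generic Sect. C map tangent to the identity: `(δ/δB)𝓗(0) = H₀`.
[cite: Balaban1985Variational, (180) p.306, (182) p.307] -/
theorem fderiv_chartH179_zero_of_tangent_flat (R : Regime 𝒢 0 W B₀ θ C₄ a₃ j a ε₄)
    (hWa : AnalyticOnNhd ℂ W {Y : 𝒴 | ‖Y‖ < a₃}) (hj : 0 < j) (ha : 0 < a) {Tm : 𝒴 → 𝒴}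
    (hTm : HasFDerivAt Tm (ContinuousLinearMap.id ℂ 𝒴) 0) (hD2 : D2 ∘L H₀ = 0) :
    fderiv ℂ (chartH179 𝒢 W D2 H₀ Tm ε₄) (0 : 𝒳) = H₀ := by
  rw [fderiv_chartH179_zero_of_tangent R hWa hj ha hTm, hD2, ContinuousLinearMap.comp_zero, add_zero]

end Origin

/-! ## 2. The (190) letter at the origin in `B11SectG`'s block-majorant currency -/

section Letters

variable {𝒳 𝒴 𝒵 : Type} [NormedAddCommGroup 𝒳] [NormedSpace ℂ 𝒳] [NormedAddCommGroup 𝒴] [NormedSpace ℂ 𝒴]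
  [NormedAddCommGroup 𝒵] [NormedSpace ℂ 𝒵] [CompleteSpace 𝒳] [CompleteSpace 𝒴] [CompleteSpace 𝒵]
  {𝒢 : 𝒵 →L[ℂ] 𝒴} {W : 𝒴 → 𝒵} {D2 : 𝒴 →L[ℂ] 𝒵} {H₀ : 𝒳 →L[ℂ] 𝒴} {B₀ θ C₄ a₃ j a ε₄ : ℝ}
  {g : B6.Geometry} {bB : BlockNorm g 𝒳} {bN : BlockNorm g 𝒴} {b3 : BlockNorm g 𝒵}

/-- Restriction of scalars of the origin derivative: `(δ/δB)𝓗(0)` as an ℝ-linear map is `H₀ + G̃Δ⁽²⁾H₀`.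
[cite: Balaban1985Variational, (182) p.307] -/
theorem restrictScalars_fderiv_chartH179_zero (R : Regime 𝒢 0 W B₀ θ C₄ a₃ j a ε₄)
    (hWa : AnalyticOnNhd ℂ W {Y : 𝒴 | ‖Y‖ < a₃}) (hj : 0 < j) (ha : 0 < a)
    {Tm : 𝒴 → 𝒴} (hTm : HasFDerivAt Tm (ContinuousLinearMap.id ℂ 𝒴) 0) :
    ((fderiv ℂ (chartH179 𝒢 W D2 H₀ Tm ε₄) (0 : 𝒳)).restrictScalars ℝ : 𝒳 →ₗ[ℝ] 𝒴) =
      (H₀.restrictScalars ℝ : 𝒳 →ₗ[ℝ] 𝒴) + ((𝒢 ∘L (D2 ∘L H₀)).restrictScalars ℝ : 𝒳 →ₗ[ℝ] 𝒴) := by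
  rw [fderiv_chartH179_zero_of_tangent R hWa hj ha hTm]
  ext x
  rfl

/-- **BLOCK MAJORANTS OF `(δ/δB)𝓗(0)` ADD UP FROM THOSE OF `H₀` AND `G̃Δ⁽²⁾H₀`** (any geometry, any block sizes, any kernels).
[cite: Balaban1985Variational, (182) p.307, (190) p.308; Balaban1984PropagatorsII, p.232] -/
theorem hasMaj_fderiv_chartH179_zero (R : Regime 𝒢 0 W B₀ θ C₄ a₃ j a ε₄) (hWa : AnalyticOnNhd ℂ W {Y : 𝒴 | ‖Y‖ < a₃})
    (hj : 0 < j) (ha : 0 < a) {Tm : 𝒴 → 𝒴} (hTm : HasFDerivAt Tm (ContinuousLinearMap.id ℂ 𝒴) 0)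
    {K₀ K₁ : g.Site → g.Site → ℝ} (hH0 : HasMaj bB bN (H₀.restrictScalars ℝ : 𝒳 →ₗ[ℝ] 𝒴) K₀)
    (hGD2H0 : HasMaj bB bN ((𝒢 ∘L (D2 ∘L H₀)).restrictScalars ℝ : 𝒳 →ₗ[ℝ] 𝒴) K₁) :
    HasMaj bB bN
      (((fderiv ℂ (chartH179 𝒢 W D2 H₀ Tm ε₄) (0 : 𝒳)).restrictScalars ℝ : 𝒳 →ₗ[ℝ] 𝒴))
      (fun y y' => K₀ y y' + K₁ y y') := by
  rw [restrictScalars_fderiv_chartH179_zero R hWa hj ha hTm]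
  exact hH0.add hGD2H0

/-- **THE (190) LETTER AT THE ORIGIN FROM TWO EXPONENTIAL LETTERS**: `H₀` with `A₀e^{−ρd}` and `G̃Δ⁽²⁾H₀` with `A₁e^{−ρd}` give
`Ineq190 bB bN ((δ/δB)𝓗(0)) (A₀ + A₁) δ` for every `δ` with `δ/8 ≤ ρ` (distances ≥ 0, `0 ≤ A₀ + A₁`).
[cite: Balaban1985Variational, (190) p.308] -/
theorem ineq190_fderiv_chartH179_zero (R : Regime 𝒢 0 W B₀ θ C₄ a₃ j a ε₄) (hWa : AnalyticOnNhd ℂ W {Y : 𝒴 | ‖Y‖ < a₃})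
    (hj : 0 < j) (ha : 0 < a) {Tm : 𝒴 → 𝒴} (hTm : HasFDerivAt Tm (ContinuousLinearMap.id ℂ 𝒴) 0)
    {A₀ A₁ ρ δ : ℝ} (hd : ∀ y y' : g.Site, 0 ≤ g.dist y y') (hA : 0 ≤ A₀ + A₁) (hδ : δ / 8 ≤ ρ)
    (hH0 : HasMaj bB bN (H₀.restrictScalars ℝ : 𝒳 →ₗ[ℝ] 𝒴) (fun y y' => A₀ * Real.exp (-(ρ * g.dist y y'))))
    (hGD2H0 : HasMaj bB bN ((𝒢 ∘L (D2 ∘L H₀)).restrictScalars ℝ : 𝒳 →ₗ[ℝ] 𝒴)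
      (fun y y' => A₁ * Real.exp (-(ρ * g.dist y y')))) :
    Ineq190 bB bN
      (((fderiv ℂ (chartH179 𝒢 W D2 H₀ Tm ε₄) (0 : 𝒳)).restrictScalars ℝ : 𝒳 →ₗ[ℝ] 𝒴))
      (A₀ + A₁) δ := by
  refine (hasMaj_fderiv_chartH179_zero R hWa hj ha hTm hH0 hGD2H0).mono fun y y' => ?_
  have hdist := hd y y'
  calc A₀ * Real.exp (-(ρ * g.dist y y')) + A₁ * Real.exp (-(ρ * g.dist y y'))
      = (A₀ + A₁) * Real.exp (-(ρ * g.dist y y')) := by ring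
    _ ≤ (A₀ + A₁) * Real.exp (-(δ / 8 * g.dist y y')) :=
        mul_le_mul_of_nonneg_left (Real.exp_le_exp.mpr (by nlinarith)) hA

/-- **THE (190) LETTER AT THE ORIGIN FROM THE THREE LOCATED LEAVES** of `B11Ineq190Actual` that survive at `B = 0`: `hH0`
(`H₀`, (129)), `hG` (G̃), `hD2H0` (Δ⁽²⁾H₀) — composed through (2.54) `htri` and the row sum (2.61) `hrow` at a rate `σ ≥ 0` with
ONE rate loss: for `0 ≤ ρ`, `ρ + σ ≤ δ₀`, constant `A₀ + κ₃·B_G·c_Δ·c`, and `Ineq190 … δ` for `δ/8 ≤ ρ`.  NO (189), NO (187)–(188),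
NO letter of `H` or `𝔇`. [cite: Balaban1985Variational, (190) p.308; Balaban1984PropagatorsII, (2.54) p.233, Lemma 2.1 (2.61) p.234] -/
theorem ineq190_fderiv_chartH179_zero_of_letters (R : Regime 𝒢 0 W B₀ θ C₄ a₃ j a ε₄)
    (hWa : AnalyticOnNhd ℂ W {Y : 𝒴 | ‖Y‖ < a₃}) (hj : 0 < j) (ha : 0 < a)
    {Tm : 𝒴 → 𝒴} (hTm : HasFDerivAt Tm (ContinuousLinearMap.id ℂ 𝒴) 0)
    {A₀ BG cΔ δ₀ ρ σ c δ : ℝ} (htri : Triangle254 g) (hd : ∀ y y' : g.Site, 0 ≤ g.dist y y') (hrow : RowSum g σ c)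
    (hc : 0 ≤ c) (hA₀ : 0 ≤ A₀) (hBG : 0 ≤ BG) (hcΔ : 0 ≤ cΔ) (hσ : 0 ≤ σ) (hρ : 0 ≤ ρ) (hρδ₀ : ρ + σ ≤ δ₀)
    (hδ : δ / 8 ≤ ρ)
    (hH0 : HasMaj bB bN (H₀.restrictScalars ℝ : 𝒳 →ₗ[ℝ] 𝒴) (fun y y' => A₀ * Real.exp (-(δ₀ * g.dist y y'))))
    (hG : HasMaj b3 bN (𝒢.restrictScalars ℝ : 𝒵 →ₗ[ℝ] 𝒴) (fun y y' => BG * Real.exp (-(δ₀ * g.dist y y'))))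
    (hD2H0 : HasMaj bB b3 ((D2 ∘L H₀).restrictScalars ℝ : 𝒳 →ₗ[ℝ] 𝒵)
      (fun y y' => cΔ * Real.exp (-(δ₀ * g.dist y y')))) :
    Ineq190 bB bN
      (((fderiv ℂ (chartH179 𝒢 W D2 H₀ Tm ε₄) (0 : 𝒳)).restrictScalars ℝ : 𝒳 →ₗ[ℝ] 𝒴))
      (A₀ + b3.κ * BG * cΔ * c) δ := by
  have hρ₂ : ρ ≤ δ₀ := by linarith
  -- the composed letter of G̃ ∘ (Δ⁽²⁾H₀) at the rate ρ ((2.54) + (2.61), one rate loss σ)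
  have hcomp : HasMaj bB bN ((𝒢 ∘L (D2 ∘L H₀)).restrictScalars ℝ : 𝒳 →ₗ[ℝ] 𝒴)
      (fun y y' => b3.κ * BG * cΔ * c * Real.exp (-(ρ * g.dist y y'))) :=
    (hasMaj_comp_exp htri hd hrow hBG hcΔ hρ hρ₂ hρδ₀ hG hD2H0).congr fun μ => rfl
  -- the letter of H₀ at the rate ρ ≤ δ₀
  have hH0' : HasMaj bB bN (H₀.restrictScalars ℝ : 𝒳 →ₗ[ℝ] 𝒴)
      (fun y y' => A₀ * Real.exp (-(ρ * g.dist y y'))) := by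
    refine hH0.mono fun y y' => mul_le_mul_of_nonneg_left (Real.exp_le_exp.mpr ?_) hA₀
    nlinarith [hd y y']
  have hA : 0 ≤ A₀ + b3.κ * BG * cΔ * c := add_nonneg hA₀ (by have := b3.κ_nonneg; positivity)
  exact ineq190_fderiv_chartH179_zero R hWa hj ha hTm hd hA hδ hH0' hcomp

/-- **FLAT BACKGROUND**: with `Δ⁽²⁾H₀ = 0` the (190) letter of `H₀` IS the (190) letter of `(δ/δB)𝓗(0)` — this is how
`RemainderDecay190TwoGridHk`'s hypothesis-free instance by Bałaban's flat `H_k` reads as NODE D for the ACTUAL derivative.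
[cite: Balaban1985Variational, (182) p.307, (190) p.308] -/
theorem ineq190_fderiv_chartH179_zero_of_flat (R : Regime 𝒢 0 W B₀ θ C₄ a₃ j a ε₄)
    (hWa : AnalyticOnNhd ℂ W {Y : 𝒴 | ‖Y‖ < a₃}) (hj : 0 < j) (ha : 0 < a)
    {Tm : 𝒴 → 𝒴} (hTm : HasFDerivAt Tm (ContinuousLinearMap.id ℂ 𝒴) 0) (hD2 : D2 ∘L H₀ = 0) {C δ : ℝ}
    (hH0 : Ineq190 bB bN (H₀.restrictScalars ℝ : 𝒳 →ₗ[ℝ] 𝒴) C δ) :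
    Ineq190 bB bN
      (((fderiv ℂ (chartH179 𝒢 W D2 H₀ Tm ε₄) (0 : 𝒳)).restrictScalars ℝ : 𝒳 →ₗ[ℝ] 𝒴)) C δ := by
  rw [fderiv_chartH179_zero_of_tangent_flat R hWa hj ha hTm hD2]
  exact hH0

end Letters

/-! ## 3. Second order at the origin: `D²𝒜₀(0)` is ONE tree graph ([I] p. 282, n(p) = 2) -/

section SecondOrder

variable {𝒳 𝒴 𝒵 : Type*} [NormedAddCommGroup 𝒳] [NormedSpace ℂ 𝒳] [NormedAddCommGroup 𝒴] [NormedSpace ℂ 𝒴]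
  [NormedAddCommGroup 𝒵] [NormedSpace ℂ 𝒵] [CompleteSpace 𝒳] [CompleteSpace 𝒴] [CompleteSpace 𝒵]
  {𝒢 : 𝒵 →L[ℂ] 𝒴} {W : 𝒴 → 𝒵} {D2 : 𝒴 →L[ℂ] 𝒵} {H₀ : 𝒳 →L[ℂ] 𝒴} {B₀ θ C₄ a₃ j a ε₄ : ℝ}

/-- (183)/(184) as an identity of CLM-valued functions near `B = 0`: `𝔄₀(B) = G̃Δ⁽²⁾H₀ − G̃((δ²/δA′²)V)(𝒜₀ + H₀B)(𝔄₀(B) + H₀)`.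
[cite: Balaban1985Variational, (183)-(184) p.307] -/
theorem fderiv_solA180_eventuallyEq (R : Regime 𝒢 0 W B₀ θ C₄ a₃ j a ε₄) (hWa : AnalyticOnNhd ℂ W {Y : 𝒴 | ‖Y‖ < a₃})
    (hj : 0 < j) (ha : 0 < a) :
    (fun B : 𝒳 => fderiv ℂ (solA180 𝒢 W D2 H₀ ε₄) B) =ᶠ[𝓝 0] fun B : 𝒳 =>
      𝒢 ∘L (D2 ∘L H₀) -
        (𝒢 ∘L fderiv ℂ W (solA180 𝒢 W D2 H₀ ε₄ B + H₀ B)) ∘L (fderiv ℂ (solA180 𝒢 W D2 H₀ ε₄) B + H₀) := by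
  have h0 : (0 : 𝒳) ∈ {B : 𝒳 | ‖H₀ B‖ < a ∧ ‖D2 (H₀ B)‖ < j} := by
    refine ⟨?_, ?_⟩ <;> simp [ha, hj]
  filter_upwards [isOpen_dom180.mem_nhds h0] with B hB
  have h := eq184 R hWa hB.2 hB.1
  rw [ContinuousLinearMap.comp_add]
  -- 𝔄₀ + T𝔄₀ = GD2H₀ − TH₀  ⟹  𝔄₀ = GD2H₀ − (T𝔄₀ + TH₀)
  calc fderiv ℂ (solA180 𝒢 W D2 H₀ ε₄) B = _ := eq_sub_of_add_eq h
    _ = _ := by abel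

/-- **THE SECOND B-DERIVATIVE OF `𝒜₀` AT THE ORIGIN IS ONE TREE GRAPH**: differentiating (183) at `B = 0` — where
`((δ²/δA′²)V)(𝒜₀(0) + H₀0) = ((δ²/δA′²)V)(0) = 0` by the regime — the term with the unknown `D𝔄₀(0)` is multiplied by zero, and
`D(𝔄₀)(0)·v = −G̃ ∘ ((δ³/δA′³)V)(0)(M v) ∘ M`, `M = (1 + G̃Δ⁽²⁾)H₀` (p. 306's «recursive system of equations» at second order, at
the origin). [cite: Balaban1985Variational, (176)-(177) p.306, (183)-(184) p.307; Balaban1987RG1, p.282] -/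
theorem fderiv_fderiv_solA180_zero (R : Regime 𝒢 0 W B₀ θ C₄ a₃ j a ε₄) (hWa : AnalyticOnNhd ℂ W {Y : 𝒴 | ‖Y‖ < a₃})
    (hj : 0 < j) (ha : 0 < a) (v : 𝒳) :
    fderiv ℂ (fderiv ℂ (solA180 𝒢 W D2 H₀ ε₄)) 0 v =
      -((𝒢 ∘L fderiv ℂ (fderiv ℂ W) 0 ((H₀ + 𝒢 ∘L (D2 ∘L H₀)) v)) ∘L (H₀ + 𝒢 ∘L (D2 ∘L H₀))) := by
  set F : 𝒳 → 𝒴 := solA180 𝒢 W D2 H₀ ε₄ with hF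
  set M : 𝒳 →L[ℂ] 𝒴 := H₀ + 𝒢 ∘L (D2 ∘L H₀) with hM
  have hJ : ‖D2 (H₀ (0 : 𝒳))‖ < j := by rw [map_zero, map_zero, norm_zero]; exact hj
  have h𝔄 : ‖H₀ (0 : 𝒳)‖ < a := by rw [map_zero, norm_zero]; exact ha
  have hbase : F 0 + H₀ 0 = 0 := base180_zero R hj.le ha
  have hF0 : fderiv ℂ F 0 = 𝒢 ∘L (D2 ∘L H₀) := fderiv_solA180_zero R hWa hj ha
  -- Y(B) = 𝒜₀(B) + H₀B has derivative M at 0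
  have hY : HasFDerivAt (fun B : 𝒳 => F B + H₀ B) M 0 := by
    have h := (hasFDerivAt_solA180 R hWa hJ h𝔄).add H₀.hasFDerivAt
    rw [hF0] at h
    rwa [hM, add_comm]
  -- fderiv W is differentiable at Y(0) = 0 (W analytic on the ball, 0 in the ball)
  have ha₃ : 0 < a₃ := by linarith [R.dom, R.ε₄_nonneg]
  have hWd : HasFDerivAt (fderiv ℂ W) (fderiv ℂ (fderiv ℂ W) 0) (F 0 + H₀ 0) := by
    rw [hbase]
    exact ((hWa 0 (by simpa using ha₃)).fderiv).differentiableAt.hasFDerivAt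
  -- c(B) := G̃ ∘L fderiv W (Y B): derivative at 0, value 0 at 0
  have hc : HasFDerivAt (fun B : 𝒳 => 𝒢 ∘L fderiv ℂ W (F B + H₀ B))
      ((ContinuousLinearMap.compL ℂ 𝒴 𝒵 𝒴 𝒢) ∘L (fderiv ℂ (fderiv ℂ W) 0 ∘L M)) 0 := by
    have h1 : HasFDerivAt (fun B : 𝒳 => fderiv ℂ W (F B + H₀ B)) (fderiv ℂ (fderiv ℂ W) 0 ∘L M) 0 := hWd.comp 0 hY
    exact (ContinuousLinearMap.compL ℂ 𝒴 𝒵 𝒴 𝒢).hasFDerivAt.comp 0 h1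
  have hc0 : 𝒢 ∘L fderiv ℂ W (F 0 + H₀ 0) = 0 := by
    rw [hbase, fderiv_W_zero R ha, ContinuousLinearMap.comp_zero]
  -- d(B) := 𝔄₀(B) + H₀ is differentiable at 0 (𝒜₀ analytic), value M
  have hd : HasFDerivAt (fun B : 𝒳 => fderiv ℂ F B + H₀) (fderiv ℂ (fderiv ℂ F) 0) 0 := by
    have h := ((analyticAt_solA180 R hWa hJ h𝔄).fderiv).differentiableAt.hasFDerivAt
    exact h.add_const H₀
  have hd0 : fderiv ℂ F 0 + H₀ = M := by rw [hF0, hM, add_comm]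
  -- the right-hand side of (183)/(184) and its derivative at 0
  have hR : HasFDerivAt (fun B : 𝒳 => 𝒢 ∘L (D2 ∘L H₀) -
      (𝒢 ∘L fderiv ℂ W (F B + H₀ B)) ∘L (fderiv ℂ F B + H₀))
      (-(((ContinuousLinearMap.compL ℂ 𝒳 𝒴 𝒴) (𝒢 ∘L fderiv ℂ W (F 0 + H₀ 0))) ∘L fderiv ℂ (fderiv ℂ F) 0 +
        ((ContinuousLinearMap.compL ℂ 𝒳 𝒴 𝒴).flip (fderiv ℂ F 0 + H₀)) ∘L
          ((ContinuousLinearMap.compL ℂ 𝒴 𝒵 𝒴 𝒢) ∘L (fderiv ℂ (fderiv ℂ W) 0 ∘L M)))) 0 :=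
    (hc.clm_comp hd).const_sub _
  have hev := fderiv_solA180_eventuallyEq (D2 := D2) (H₀ := H₀) R hWa hj ha
  rw [hev.fderiv_eq, hR.fderiv, hc0, hd0]
  simp only [map_zero, ContinuousLinearMap.zero_comp, zero_add, neg_apply, ContinuousLinearMap.comp_apply,
    ContinuousLinearMap.flip_apply, ContinuousLinearMap.compL_apply]

/-- The same applied to a second direction `u`: `D²𝒜₀(0)[u, v] = −G̃(((δ³/δA′³)V)(0) (M v) (M u))`.
[cite: Balaban1985Variational, (183)-(184) p.307; Balaban1987RG1, p.282] -/
theorem fderiv_fderiv_solA180_zero_apply (R : Regime 𝒢 0 W B₀ θ C₄ a₃ j a ε₄)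
    (hWa : AnalyticOnNhd ℂ W {Y : 𝒴 | ‖Y‖ < a₃}) (hj : 0 < j) (ha : 0 < a) (u v : 𝒳) :
    fderiv ℂ (fderiv ℂ (solA180 𝒢 W D2 H₀ ε₄)) 0 v u =
      -𝒢 (fderiv ℂ (fderiv ℂ W) 0 ((H₀ + 𝒢 ∘L (D2 ∘L H₀)) v) ((H₀ + 𝒢 ∘L (D2 ∘L H₀)) u)) := by
  rw [fderiv_fderiv_solA180_zero R hWa hj ha v, neg_apply, ContinuousLinearMap.comp_apply,
    ContinuousLinearMap.comp_apply]

end SecondOrder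

/-! ## 4. Second order at the origin for the CHART: two tree graphs ([I] p. 282, n(p) = 2)

v1.3 (generation 103, append-only): `fderiv_fderiv_chartH179_zero` — for `𝓗 = Tm(𝒜₀ + H₀·)` with `Tm` analytic at `0` and
`fderiv Tm 0 = id`: `D(D𝓗)(0)·v = (D²Tm(0)(M v)) ∘ M − (G̃ ∘ ((δ³/δA′³)V)(0)(M v)) ∘ M` — §3's tree graph plus the vertex of
the Sect. C map ((78): `−HD⁽²⁾ = −HC⁽²⁾`), each with two legs `M = (1 + G̃Δ⁽²⁾)H₀`; no Neumann series, no (189). -/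

section SecondOrderChart

variable {𝒳 𝒴 𝒵 : Type*} [NormedAddCommGroup 𝒳] [NormedSpace ℂ 𝒳] [NormedAddCommGroup 𝒴] [NormedSpace ℂ 𝒴]
  [NormedAddCommGroup 𝒵] [NormedSpace ℂ 𝒵] [CompleteSpace 𝒳] [CompleteSpace 𝒴] [CompleteSpace 𝒵]
  {𝒢 : 𝒵 →L[ℂ] 𝒴} {W : 𝒴 → 𝒵} {D2 : 𝒴 →L[ℂ] 𝒵} {H₀ : 𝒳 →L[ℂ] 𝒴} {B₀ θ C₄ a₃ j a ε₄ : ℝ}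

/-- **THE SECOND B-DERIVATIVE OF THE CHART AT THE ORIGIN IS A SUM OF TWO TREE GRAPHS**: for `𝓗(B) = Tm(𝒜₀(B) + H₀B)` with a
Sect. C map `Tm` analytic at `0`, `Tm(0)`-tangent to the identity (`fderiv Tm 0 = id`),
`D(D𝓗)(0)·v = (D²Tm(0)(M v)) ∘ M − (G̃ ∘ ((δ³/δA′³)V)(0)(M v)) ∘ M`, `M = (1 + G̃Δ⁽²⁾)H₀` — the vertex of the Sect. C map
(print: `−HD⁽²⁾ = −HC⁽²⁾`, (78)) and the cubic vertex of `V`, each with two legs `M`; no Neumann series, no (189).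
[cite: Balaban1987RG1, p.282; Balaban1985Variational, (78) p.290, (176)-(177) p.306, (179) p.306, (182)-(184) p.307] -/
theorem fderiv_fderiv_chartH179_zero (R : Regime 𝒢 0 W B₀ θ C₄ a₃ j a ε₄) (hWa : AnalyticOnNhd ℂ W {Y : 𝒴 | ‖Y‖ < a₃})
    (hj : 0 < j) (ha : 0 < a) {Tm : 𝒴 → 𝒴} (hTmA : AnalyticAt ℂ Tm 0)
    (hTm : fderiv ℂ Tm 0 = ContinuousLinearMap.id ℂ 𝒴) (v : 𝒳) :
    fderiv ℂ (fderiv ℂ (chartH179 𝒢 W D2 H₀ Tm ε₄)) 0 v =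
      (fderiv ℂ (fderiv ℂ Tm) 0 ((H₀ + 𝒢 ∘L (D2 ∘L H₀)) v)) ∘L (H₀ + 𝒢 ∘L (D2 ∘L H₀)) -
        (𝒢 ∘L fderiv ℂ (fderiv ℂ W) 0 ((H₀ + 𝒢 ∘L (D2 ∘L H₀)) v)) ∘L (H₀ + 𝒢 ∘L (D2 ∘L H₀)) := by
  set F : 𝒳 → 𝒴 := solA180 𝒢 W D2 H₀ ε₄ with hF
  set M : 𝒳 →L[ℂ] 𝒴 := H₀ + 𝒢 ∘L (D2 ∘L H₀) with hM
  have hJ : ‖D2 (H₀ (0 : 𝒳))‖ < j := by rw [map_zero, map_zero, norm_zero]; exact hj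
  have h𝔄 : ‖H₀ (0 : 𝒳)‖ < a := by rw [map_zero, norm_zero]; exact ha
  have hbase : F 0 + H₀ 0 = 0 := base180_zero R hj.le ha
  have hF0 : fderiv ℂ F 0 = 𝒢 ∘L (D2 ∘L H₀) := fderiv_solA180_zero R hWa hj ha
  -- Y(B) = 𝒜₀(B) + H₀B: analytic near 0, derivative M at 0, Y(0) = 0
  have hYd : ∀ᶠ B in 𝓝 (0 : 𝒳), HasFDerivAt (fun B : 𝒳 => F B + H₀ B) (fderiv ℂ F B + H₀) B := by
    have h0 : (0 : 𝒳) ∈ {B : 𝒳 | ‖H₀ B‖ < a ∧ ‖D2 (H₀ B)‖ < j} := ⟨h𝔄, hJ⟩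
    filter_upwards [isOpen_dom180.mem_nhds h0] with B hB
    exact (hasFDerivAt_solA180 R hWa hB.2 hB.1).add H₀.hasFDerivAt
  have hY : HasFDerivAt (fun B : 𝒳 => F B + H₀ B) M 0 := by
    have h := hYd.self_of_nhds
    rw [hF0] at h
    rwa [hM, add_comm]
  -- Tm is differentiable at Y(B) for B near 0
  have hYcont : ContinuousAt (fun B : 𝒳 => F B + H₀ B) 0 := hY.continuousAt
  have hTmY : ∀ᶠ B in 𝓝 (0 : 𝒳), DifferentiableAt ℂ Tm (F B + H₀ B) := by
    have hev : ∀ᶠ Y in 𝓝 (F 0 + H₀ 0), AnalyticAt ℂ Tm Y := by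
      rw [hbase]; exact hTmA.eventually_analyticAt
    exact (hYcont.tendsto.eventually hev).mono fun B hB => hB.differentiableAt
  -- chain rule near 0: D𝓗(B) = DTm(Y B) ∘ (𝔄₀(B) + H₀)
  have hev : (fun B : 𝒳 => fderiv ℂ (chartH179 𝒢 W D2 H₀ Tm ε₄) B) =ᶠ[𝓝 0] fun B : 𝒳 =>
      (fderiv ℂ Tm (F B + H₀ B)) ∘L (fderiv ℂ F B + H₀) := by
    filter_upwards [hYd, hTmY] with B hB1 hB2
    have hc : HasFDerivAt (chartH179 𝒢 W D2 H₀ Tm ε₄) ((fderiv ℂ Tm (F B + H₀ B)) ∘L (fderiv ℂ F B + H₀)) B := by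
      have h := hB2.hasFDerivAt.comp B hB1
      exact h
    exact hc.fderiv
  -- the two factors and their derivatives at 0
  have hc : HasFDerivAt (fun B : 𝒳 => fderiv ℂ Tm (F B + H₀ B)) (fderiv ℂ (fderiv ℂ Tm) 0 ∘L M) 0 := by
    have h1 : HasFDerivAt (fderiv ℂ Tm) (fderiv ℂ (fderiv ℂ Tm) 0) (F 0 + H₀ 0) := by
      rw [hbase]; exact hTmA.fderiv.differentiableAt.hasFDerivAt
    exact h1.comp 0 hY
  have hc0 : fderiv ℂ Tm (F 0 + H₀ 0) = ContinuousLinearMap.id ℂ 𝒴 := by rw [hbase, hTm]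
  have hd : HasFDerivAt (fun B : 𝒳 => fderiv ℂ F B + H₀) (fderiv ℂ (fderiv ℂ F) 0) 0 :=
    (((analyticAt_solA180 R hWa hJ h𝔄).fderiv).differentiableAt.hasFDerivAt).add_const H₀
  have hd0 : fderiv ℂ F 0 + H₀ = M := by rw [hF0, hM, add_comm]
  have hprod := hc.clm_comp hd
  rw [hev.fderiv_eq, hprod.fderiv, hc0, hd0]
  simp only [add_apply, ContinuousLinearMap.comp_apply, ContinuousLinearMap.flip_apply,
    ContinuousLinearMap.compL_apply, ContinuousLinearMap.id_comp]
  rw [fderiv_fderiv_solA180_zero R hWa hj ha v, ← hM]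
  abel

end SecondOrderChart


end

end Literature.MathematicalPhysics.QuantumFieldTheory.Balaban1983to89.Beta.RemainderChartOriginDerivative
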